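import Mathlib.NumberTheory.Padics.HeightOneSpectrum
import Mathlib.NumberTheory.Padics.RingHoms
import Literature.NumberTheory.GaloisRepresentations.GaloisCohomologyKummerProofs
import Literature.NumberTheory.GaloisRepresentations.LocalGlobalCohomology
import HarnessLib

/-!
# `Ш¹(ℚ, μ_n) = 0`: a rational number which is an `n`-th power in every `ℚ_p` is an `n`-th power
# (Harari, *Galois Cohomology and Class Field Theory*, Thm. 18.9 for `k = ℚ`)

Theorems only (no definition, no named fact).  Harari, Thm. 18.9 / Cor. 18.13 (Grunwald–Wang):
for a global field `k` outside an exceptional case, `H¹(k, μ_m) → ∏_v H¹(k_v, μ_m)` is injective,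
"In particular, `Ш¹_S(k, μ_m) = 0`"; Remark 18.14: the first exceptional example is Wang's
`k = ℚ`, `T = Ω_ℚ - {2}`, `m = 8`.  For `k = ℚ` and ALL places no exception occurs, and the
statement is elementary: by Kummer theory (`H¹(ℚ, μ_n) = ℚ^×/ℚ^{×n}`, the tree's `kummerMap`,
`GaloisCohomologyKummerProofs.lean`) it says that a rational number which is an `n`-th power in
`ℚ_p` for every prime `p` is an `n`-th power in `ℚ`, which follows from unique factorisation
(`n ∣ v_p(a)` for all `p`, so `a = ± bⁿ`) and, for the sign when `n` is even, from `-1` not being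
a square in `ℚ_3`.

* `exists_eq_pow_of_pullback_kummerMap_eq_zero` — for any extension `L/K` (`L` of
  characteristic `0`): if the Kummer class of `a ∈ K^×` restricts to `0` in `H¹(L, μ_n)` (along
  the tree's `absGaloisRestrict K L`, coefficients `μ_n(K̄)`), then `a` is an `n`-th power in `L`
  (cocycle level: `σ(α)/α = σ(η)/η` on `Γ_L` for some `η ∈ μ_n`, so `α/η`, embedded in `L̄`, is
  `Γ_L`-fixed, i.e. in `L`, and `(α/η)ⁿ = a`);
* `Rat.exists_eq_pow_or_eq_neg_pow_of_forall_dvd_padicValRat`, `Rat.exists_eq_pow_of_forall_padic`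
  — the arithmetic of `ℚ`;
* `sha_mu_rat_eq_bot` — **`Ш¹(ℚ, μ_n) = 0`** (`DiscreteGaloisModule.sha (mu ℚ n) = ⊥`, all
  places, the tree's `LocalGlobalCohomology.lean` vocabulary), the input `Ш¹(k, μ_m) = 0` of the
  local–global principle for `H²(ℚ, ℤ/n)` (`PoitouTateSha.lean`, Harari Cor. 18.12).

## References

* D. Harari, *Galois Cohomology and Class Field Theory* (2020), Thm. 18.9, Cor. 18.13,
  Rem. 18.14. [Harari2020]
* J.-P. Serre, *Local Fields* (1979), X §3 (Kummer theory). [SerreLocalFields1979]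
-/

noncomputable section

open Function Field NumberField IsDedekindDomain

namespace Literature.NumberTheory.GaloisCohomology

open Literature.NumberTheory.GaloisRepresentations
open Literature.NumberTheory.GaloisRepresentations.DiscreteGaloisModule

/-! ### Local triviality of a Kummer class means: an `n`-th power locally -/

section KummerLocal

variable (K L : Type) [Field K] [Field L] [Algebra K L] [CharZero L] (n : ℕ) [NeZero (n : K)]

/-- **A Kummer class that restricts to zero over `L` comes from an `n`-th power of `L`.**  For an
extension `L/K` and `a ∈ K^×`: if the pull-back of the Kummer class `δ(a) ∈ H¹(K, μ_n)` along
`Γ_L → Γ_K` (the tree's `galoisCohomology.pullback` / `res`, coefficients `μ_n(K̄)` restricted) is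
`0`, then `a = cⁿ` for some `c ∈ L`.  (On cocycles: `σ(α)/α = σ(η)/η` for `σ ∈ Γ_L` and some
`η ∈ μ_n(K̄)`, `αⁿ = a`; then the image of `α/η` in `L̄` is fixed by `Γ_L`, hence lies in `L`.)
[cite: SerreLocalFields1979, X §3] -/
theorem exists_eq_pow_of_pullback_kummerMap_eq_zero (a : Kˣ)
    (h : galoisCohomology.pullback (mu K n) (absGaloisRestrict K L) 1
      (kummerMap K n a).toAdd = 0) :
    ∃ c : L, algebraMap K L a = c ^ n := by
  -- the Kummer cocycle of a chosen root `α`, `αⁿ = a`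
  set α : kummerUnits K n := kummerUnitsRoot K n a with hα_def
  have hx : (kummerMap K n a).toAdd =
      oneCocycleClass (mu K n).toTopRep (kummerOneCocycle K n α) := rfl
  rw [hx] at h
  change (ContinuousCohomology.map (absGaloisRestrict K L) (X := (mu K n).toTopRep)
    (Y := DiscreteGaloisModule.toTopRep (ContinuousRep.restrict (mu K n) (absGaloisRestrict K L)))
    (TopRep.ofHom ⟨ContinuousLinearMap.id ℤ (MuCarrier K n), fun _ => rfl⟩) 1).hom
      (oneCocycleClass (mu K n).toTopRep (kummerOneCocycle K n α)) = 0 at h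
  erw [map_oneCocycleClass] at h
  rw [oneCocycleClass_eq_zero_iff] at h
  obtain ⟨v, hv⟩ := h
  -- `σ(α)/α = σ(η)/η` for `σ ∈ Γ_L`, `η = muVal v`
  set η : (AlgebraicClosure K)ˣ := muVal K n v with hη_def
  have hquot : ∀ τ : absoluteGaloisGroup L,
      absGaloisRestrict K L τ • (α : (AlgebraicClosure K)ˣ) / (α : (AlgebraicClosure K)ˣ) =
        absGaloisRestrict K L τ • η / η := by
    intro τ
    have h1 := congrArg (muVal K n) (hv τ)
    rw [contOneCocycles.pullback_apply] at h1
    exact h1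
  have hfix : ∀ τ : absoluteGaloisGroup L,
      absGaloisRestrict K L τ • ((α : (AlgebraicClosure K)ˣ) / η) =
        (α : (AlgebraicClosure K)ˣ) / η := by
    intro τ
    rw [smul_div', div_eq_div_iff_mul_eq_mul]
    have h2 := hquot τ
    rw [div_eq_div_iff_mul_eq_mul] at h2
    rw [mul_comm (α : (AlgebraicClosure K)ˣ)]
    exact h2
  -- `β = α/η ∈ K̄`, its image in `L̄` is `Γ_L`-fixed, hence in `L`
  set β : AlgebraicClosure K := (((α : (AlgebraicClosure K)ˣ) / η : (AlgebraicClosure K)ˣ) :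
    AlgebraicClosure K) with hβ_def
  have hβfix : ∀ τ : absoluteGaloisGroup L,
      τ • absClosureEmbedding K L β = absClosureEmbedding K L β := by
    intro τ
    rw [← absGaloisRestrict_apply_smul]
    congr 1
    rw [hβ_def, ← Units.coe_smul, hfix τ]
  obtain ⟨m, c, hc⟩ :=
    absoluteGaloisGroup.exists_algebraMap_eq_pow_of_forall_smul_eq L 1 hβfix
  rw [one_pow, pow_one] at hc
  refine ⟨c, ?_⟩
  -- `βⁿ = a`
  have hβn : β ^ n = algebraMap K (AlgebraicClosure K) a := by
    rw [hβ_def, ← Units.val_pow_eq_pow_val, div_pow, hα_def, kummerUnitsRoot_pow,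
      hη_def, muVal_pow_eq_one, div_one, Units.coe_map, MonoidHom.coe_coe]
  apply (algebraMap L (AlgebraicClosure L)).injective
  rw [map_pow, hc, ← map_pow, hβn, AlgHom.commutes]
  exact (IsScalarTower.algebraMap_apply K L (AlgebraicClosure L) (a : K)).symm

end KummerLocal

/-! ### Arithmetic of `ℚ`: everywhere locally an `n`-th power implies an `n`-th power -/

section RatArith

/-- A natural number all of whose `p`-adic valuations are divisible by `m` is an `m`-th power.
[folklore] -/
theorem Nat.exists_eq_pow_of_forall_dvd_padicValNat {N m : ℕ} (hN : N ≠ 0)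
    (h : ∀ p : ℕ, p.Prime → m ∣ padicValNat p N) : ∃ r : ℕ, N = r ^ m := by
  classical
  refine ⟨N.factorization.prod fun p k => p ^ (k / m), ?_⟩
  rw [Finsupp.prod, ← Finset.prod_pow]
  conv_lhs => rw [← Nat.prod_factorization_pow_eq_self hN]
  rw [Finsupp.prod]
  refine Finset.prod_congr rfl fun p hp => ?_
  have hp' : p.Prime := Nat.prime_of_mem_primeFactors (by rwa [Nat.support_factorization] at hp)
  have hdvd : m ∣ N.factorization p := by
    rw [Nat.factorization_def N hp']
    exact h p hp'
  rw [← pow_mul, Nat.div_mul_cancel hdvd]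

/-- A non-zero rational number all of whose `p`-adic valuations are divisible by `m` is `± bᵐ`.
[folklore] -/
theorem Rat.exists_eq_pow_or_eq_neg_pow_of_forall_dvd_padicValRat {a : ℚ} (ha : a ≠ 0) {m : ℕ}
    (h : ∀ p : ℕ, p.Prime → (m : ℤ) ∣ padicValRat p a) :
    ∃ b : ℚ, a = b ^ m ∨ a = -(b ^ m) := by
  have hnum0 : a.num ≠ 0 := Rat.num_ne_zero.2 ha
  -- `m ∣ v_p(|num|)` and `m ∣ v_p(den)` separately (numerator and denominator are coprime)
  have hsplit : ∀ p : ℕ, p.Prime → m ∣ padicValNat p a.num.natAbs ∧ m ∣ padicValNat p a.den := by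
    intro p hp
    haveI : Fact p.Prime := ⟨hp⟩
    have hv := h p hp
    rw [padicValRat_def, padicValInt] at hv
    by_cases hpn : p ∣ a.num.natAbs
    · have hpd : ¬ p ∣ a.den := fun hpd => by
        have h1 : p ∣ Nat.gcd a.num.natAbs a.den := Nat.dvd_gcd hpn hpd
        rw [Nat.Coprime.gcd_eq_one a.reduced] at h1
        exact hp.one_lt.ne' (Nat.dvd_one.1 h1)
      have h0 : padicValNat p a.den = 0 := padicValNat.eq_zero_of_not_dvd hpd
      rw [h0, Nat.cast_zero, sub_zero] at hv
      exact ⟨Int.natCast_dvd_natCast.1 hv, by rw [h0]; exact dvd_zero _⟩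
    · have h0 : padicValNat p a.num.natAbs = 0 := padicValNat.eq_zero_of_not_dvd hpn
      rw [h0, Nat.cast_zero, zero_sub, dvd_neg] at hv
      exact ⟨by rw [h0]; exact dvd_zero _, Int.natCast_dvd_natCast.1 hv⟩
  obtain ⟨r₁, hr₁⟩ := Nat.exists_eq_pow_of_forall_dvd_padicValNat
    (Int.natAbs_ne_zero.2 hnum0) fun p hp => (hsplit p hp).1
  obtain ⟨r₂, hr₂⟩ := Nat.exists_eq_pow_of_forall_dvd_padicValNat a.den_nz
    fun p hp => (hsplit p hp).2
  refine ⟨(r₁ : ℚ) / r₂, ?_⟩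
  have hden : (a.den : ℚ) = (r₂ : ℚ) ^ m := by rw [hr₂]; push_cast; rfl
  rcases lt_or_gt_of_ne hnum0 with hneg | hpos
  · right
    have hnum : (a.num : ℚ) = -((r₁ : ℚ) ^ m) := by
      have e : ((a.num.natAbs : ℤ) : ℚ) = ((r₁ ^ m : ℕ) : ℚ) := by rw [hr₁]; norm_cast
      rw [Int.ofNat_natAbs_of_nonpos hneg.le] at e
      push_cast at e
      linarith
    rw [← Rat.num_div_den a, hnum, hden, div_pow, neg_div]
  · left
    have hnum : (a.num : ℚ) = (r₁ : ℚ) ^ m := by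
      have e : ((a.num.natAbs : ℤ) : ℚ) = ((r₁ ^ m : ℕ) : ℚ) := by rw [hr₁]; norm_cast
      rw [Int.natAbs_of_nonneg hpos.le] at e
      push_cast at e
      exact e
    rw [← Rat.num_div_den a, hnum, hden, div_pow]

/-- `-1` is not a square in `ℚ_3` (a square root would be a `3`-adic unit whose reduction
squares to `-1` in `𝔽_3`). [folklore] -/
theorem not_isSquare_neg_one_padic_three : ¬ IsSquare (-1 : ℚ_[3]) := by
  have key : ∀ z : ZMod 3, z * z ≠ -1 := by decide
  haveI : Fact (Nat.Prime 3) := ⟨Nat.prime_three⟩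
  rintro ⟨d, hd⟩
  have hnorm : ‖d‖ = 1 := by
    have h1 : ‖d‖ * ‖d‖ = 1 := by rw [← norm_mul, ← hd, norm_neg, norm_one]
    have h0 : 0 ≤ ‖d‖ := norm_nonneg d
    nlinarith [mul_self_eq_one_iff.1 h1]
  let d' : ℤ_[3] := ⟨d, hnorm.le⟩
  have hd' : d' * d' = -1 := Subtype.ext (by
    change d * d = ((-1 : ℤ_[3]) : ℚ_[3])
    rw [← hd]
    rfl)
  have hz : PadicInt.toZMod d' * PadicInt.toZMod d' = -1 := by
    rw [← map_mul, hd', map_neg, map_one]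
  exact key _ hz

/-- **A non-zero rational number which is an `m`-th power in `ℚ_p` for every prime `p` is an
`m`-th power in `ℚ`** (`m ≥ 1`): `m ∣ v_p(a)` for all `p` gives `a = ± bᵐ`, and if `m` is even
the sign is `+` because `-1 = (c/b)ᵐ` is not a square in `ℚ_3`.  This is `Ш¹(ℚ, μ_m) = 0` in
elementary terms. [cite: Harari2020, Cor. 18.13 and Rem. 18.14] -/
theorem Rat.exists_eq_pow_of_forall_padic {a : ℚ} (ha : a ≠ 0) {m : ℕ} (hm : 0 < m)
    (hloc : ∀ (p : ℕ) [Fact p.Prime], ∃ c : ℚ_[p], (a : ℚ_[p]) = c ^ m) :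
    ∃ b : ℚ, a = b ^ m := by
  have hval : ∀ p : ℕ, p.Prime → (m : ℤ) ∣ padicValRat p a := by
    intro p hp
    haveI : Fact p.Prime := ⟨hp⟩
    obtain ⟨c, hc⟩ := hloc p
    refine ⟨c.valuation, ?_⟩
    rw [← Padic.valuation_ratCast, hc, Padic.valuation_pow]
  obtain ⟨b, hb | hb⟩ := Rat.exists_eq_pow_or_eq_neg_pow_of_forall_dvd_padicValRat ha hval
  · exact ⟨b, hb⟩
  · rcases Nat.even_or_odd m with heven | hodd
    · -- `m` even: impossible, `-1` would be a square in `ℚ_3`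
      exfalso
      haveI : Fact (Nat.Prime 3) := ⟨Nat.prime_three⟩
      obtain ⟨c, hc⟩ := hloc 3
      have hb0 : (b : ℚ_[3]) ≠ 0 := by
        intro h0
        apply ha
        have : (b : ℚ) = 0 := by exact_mod_cast h0
        rw [hb, this, zero_pow hm.ne', neg_zero]
      obtain ⟨k, hk⟩ := heven
      apply not_isSquare_neg_one_padic_three
      refine ⟨(c / b) ^ k, ?_⟩
      rw [← pow_two, ← pow_mul, show k * 2 = m by omega, div_pow, ← hc, hb]
      push_cast
      rw [neg_div, div_self (pow_ne_zero m hb0)]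
    · exact ⟨-b, by rw [hodd.neg_pow, hb]⟩

end RatArith

/-! ### `Ш¹(ℚ, μ_n) = 0` -/

section Sha

/-- **`Ш¹(ℚ, μ_n) = 0`** (Harari, Thm. 18.9 / Cor. 18.13 for `k = ℚ`, all places): a class of
`H¹(ℚ, μ_n)` which vanishes in `H¹(ℚ_v, μ_n)` at every place `v` is `0`.  Proof: the class is the
Kummer class of some `a ∈ ℚ^×` (`kummerMap_surjective`); vanishing at the finite place `v = p`
makes `a` an `n`-th power in `ℚ_v ≅ ℚ_p` (`exists_eq_pow_of_pullback_kummerMap_eq_zero`, Mathlib's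
`Rat.HeightOneSpectrum.adicCompletion.padicEquiv`); hence `a` is an `n`-th power in `ℚ`
(`Rat.exists_eq_pow_of_forall_padic`) and its Kummer class vanishes.
[cite: Harari2020, Thm. 18.9 and Cor. 18.13] -/
theorem sha_mu_rat_eq_bot (n : ℕ) [NeZero n] : sha (mu ℚ n) = ⊥ := by
  classical
  haveI : NeZero ((n : ℕ) : ℚ) := ⟨Nat.cast_ne_zero.2 (NeZero.ne n)⟩
  rw [eq_bot_iff]
  intro y hy
  rw [AddSubgroup.mem_bot]
  rw [mem_sha_iff] at hy
  -- `y = δ(a)` for some `a ∈ ℚˣ`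
  obtain ⟨a, ha⟩ := kummerMap_surjective ℚ n (Multiplicative.ofAdd y)
  have hya : y = (kummerMap ℚ n a).toAdd := by rw [ha]; rfl
  -- at every finite place `v`, `a` is an `n`-th power in `ℚ_v`
  have hlocv : ∀ v : HeightOneSpectrum (𝓞 ℚ), ∃ c : v.adicCompletion ℚ,
      ((a : ℚ) : v.adicCompletion ℚ) = c ^ n := by
    intro v
    haveI : CharZero (v.adicCompletion ℚ) :=
      charZero_of_injective_algebraMap (algebraMap ℚ (v.adicCompletion ℚ)).injective
    have h := hy (Sum.inr v)
    rw [hya] at h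
    obtain ⟨c, hc⟩ := @exists_eq_pow_of_pullback_kummerMap_eq_zero ℚ (v.adicCompletion ℚ) _ _
      (HeightOneSpectrum.instAlgebraAdicCompletion (𝓞 ℚ) ℚ v) _ n _ a h
    exact ⟨c, (eq_ratCast _ (a : ℚ)).symm.trans hc⟩
  -- hence in every `ℚ_p`
  have hloc : ∀ (p : ℕ) [Fact p.Prime], ∃ c : ℚ_[p], ((a : ℚ) : ℚ_[p]) = c ^ n := by
    intro p hp
    obtain ⟨v, hv⟩ := (Rat.HeightOneSpectrum.primesEquiv (R := 𝓞 ℚ)).surjective ⟨p, hp.1⟩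
    have hpv : ((Rat.HeightOneSpectrum.primesEquiv (R := 𝓞 ℚ) v : Nat.Primes) : ℕ) = p :=
      congrArg Subtype.val hv
    subst hpv
    obtain ⟨c, hc⟩ := hlocv v
    let e := Rat.HeightOneSpectrum.adicCompletion.padicEquiv (R := 𝓞 ℚ) v
    refine ⟨e c, ?_⟩
    have h1 := congrArg e hc
    rw [map_pow, map_ratCast] at h1
    exact h1
  -- so `a = bⁿ` in `ℚ`, and `δ(a) = 0`
  obtain ⟨b, hb⟩ := Rat.exists_eq_pow_of_forall_padic a.ne_zero (NeZero.pos n) hloc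
  have hb0 : b ≠ 0 := by
    intro h0
    rw [h0, zero_pow (NeZero.ne n)] at hb
    exact a.ne_zero hb
  have hmem : a ∈ (powMonoidHom n : ℚˣ →* ℚˣ).range :=
    ⟨Units.mk0 b hb0, Units.ext (by rw [powMonoidHom_apply, Units.val_pow_eq_pow_val,
      Units.val_mk0, hb])⟩
  have hker := range_powMonoidHom_le_ker_kummerMap ℚ n hmem
  rw [MonoidHom.mem_ker] at hker
  rw [hya, hker]
  rfl

end Sha

end Literature.NumberTheory.GaloisCohomology

end
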